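import Mathlib
import HarnessLib
import Summits.HubbardSuperconductivity.HubbardSuperconductivity.Theorems.ChiralWindowDefs

/-!
# Certificate vocabulary, RESIDUAL FORM, for the crux `CwKLChiralWindow` (route `ChiralWindow`, line `Sketch`)

Companion of `Theorems/ChiralWindowDefs.lean` (same record types `KLTrig`, `KLBlock`, `KLBox`, `KLCert`; crux item
stmt-HubbardSuperconductivity-1741).  The original checker `KLCert.check` consumes, for every trial block, an enclosure of the
image norm `T = ∫ (∫ κ Φ)²` (interface E3) and measures the quality of the trial through `alpha - rhohi²`
(`alpha = Thi/Nlo`), into which the enclosure widths of `T` AND of the Rayleigh numerator `Q` enter at first order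
(`2|ρ|·(ρhi - ρlo)`): with realistic certified widths this swamps the true residual of the trial, costs most of the Temple
margin and defeats the Kato node-covering test (lead c4, `Cruxes/CwKLChiralWindow/CertInterface.md` v2 §9).

The residual form removes that coupling.  The SAME record is read differently on trial blocks (`useTrial = true`):
* field `Thi` is an upper bound `Ehi` for the RESIDUAL INTEGRAL `∫ (F(k) - s·Φ(k))² dσ_μ(k)`, `F = ∫ κ(k,k') Φ(k') dσ_μ(k')`,
  with the SHIFT `s` = field `s` of the block (any rational; the natural choice is the float Rayleigh quotient) — interface E3R;
* `etil = Thi/Nlo ≥ ‖(A - s)Φ̂‖² ≥ ‖(A - ρ)Φ̂‖²` (`ρ = Q/N` minimises the shifted residual) replaces `alpha - ρ²` everywhere: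
  Temple's bound becomes `templeR ρ = (β ρ - ρ² - etil)/(β - ρ)` (concave in `ρ`, so its minimum over `[rholo, rhohi]` is at an
  end point) and Kato's squared distance becomes `katoR = etil/(β - rhohi)²`;
* far blocks (`useTrial = false`) are unchanged (`farOK`, bound `-s`); a trial block no longer doubles as a far block.
Everything else (`ritzOK`, `deflOK`, `farOK`, `rholo`, `rhohi`, `upper`, `dmult`, the node enclosures `KLBox.NodeEnclosure`, the
box/record structure, `chainOK`) is reused verbatim.  This file only NAMES the residual-form objects (`KLBlock.EnclosureR`,
`templeR`, `templeOKR`, `lowerOKR`, `lowerR`, `katoR`, `KLBox.basicOKR/isolationOKR/b1gLeadsOKR/eLeadsOKR/nodeOKR`,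
`KLCert.EnclosuresR`, `KLCert.checkR`); soundness (`checkR = true → EnclosuresR → clauses N0–N5`) is proved in the companion
Theorems files.  References: Reed–Simon IV Thm. XIII.5 (Temple), Kato *Perturbation theory* §VI.4 / Davis–Kahan (eigenvector
enclosure by the residual), the tree's `TempleCertificate`.
-/

noncomputable section

namespace Summit.HubbardSuperconductivity.HubbardSuperconductivity.Theorems.CwKLChiralWindow

set_option linter.dupNamespace false -- summit = problem name (single-conjunct summit), D-0017

open MeasureTheory Literature.MathematicalPhysics.QuantumLattice

namespace KLBlock

/-- **The enclosure statements of a block, residual form** at the level `μ` in the channel `χ` (interface E1, E2, E3R, E4):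
with `σ = σ_μ`, `Φ` the trial, `F(k) = ∫ κ(k,k') Φ(k') dσ`: if the trial is used then `Nlo ≤ ∫Φ² ≤ Nhi`, `Qlo ≤ ∫ Φ F ≤ Qhi`
and the RESIDUAL bound `∫ (F - s·Φ)² dσ ≤ Thi` (field `Thi` read as `Ehi`, field `s` read as the shift); and always
`∫∫ (K_χ - Σ c u⊗u)² d(σ⊗σ) ≤ Hhi`. [folklore] -/
def EnclosureR (b : KLBlock) (tab : List KLTrig) (μ : ℝ) (χ : D4Irrep) : Prop :=
  (b.useTrial = true →
    (b.Nlo : ℝ) ≤ ∫ k, b.trialFun tab k ^ 2 ∂fermiCurveMeasure (squareDispersion 1 0) μ ∧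
    ∫ k, b.trialFun tab k ^ 2 ∂fermiCurveMeasure (squareDispersion 1 0) μ ≤ (b.Nhi : ℝ) ∧
    (b.Qlo : ℝ) ≤ ∫ k, b.trialFun tab k *
        ∫ k', b.baseKernel μ k k' * b.trialFun tab k' ∂fermiCurveMeasure (squareDispersion 1 0) μ
        ∂fermiCurveMeasure (squareDispersion 1 0) μ ∧
    ∫ k, b.trialFun tab k *
        ∫ k', b.baseKernel μ k k' * b.trialFun tab k' ∂fermiCurveMeasure (squareDispersion 1 0) μ
        ∂fermiCurveMeasure (squareDispersion 1 0) μ ≤ (b.Qhi : ℝ) ∧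
    ∫ k, (∫ k', b.baseKernel μ k k' * b.trialFun tab k' ∂fermiCurveMeasure (squareDispersion 1 0) μ -
        (b.s : ℝ) * b.trialFun tab k) ^ 2 ∂fermiCurveMeasure (squareDispersion 1 0) μ ≤ (b.Thi : ℝ)) ∧
  ∫ z, (b.sectorKernel μ χ z.1 z.2 - b.deflKernel tab z.1 z.2) ^ 2
      ∂(fermiCurveMeasure (squareDispersion 1 0) μ).prod (fermiCurveMeasure (squareDispersion 1 0) μ) ≤ (b.Hhi : ℝ)

/-! #### The rational bookkeeping of a block, residual form -/

/-- Upper bound `Thi / Nlo` for the normalised squared residual `‖(A - s) Φ̂‖²` (hence for `‖(A - ρ) Φ̂‖²`). [folklore] -/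
def etil (b : KLBlock) : ℚ := b.Thi / b.Nlo

/-- The residual-form Temple certificate function `(β ρ - ρ² - ẽ)/(β - ρ)` (`= ρ - ẽ/(β - ρ)`).
[cite: ReedSimonIV1978, Thm. XIII.5] -/
def templeR (b : KLBlock) (ρ : ℚ) : ℚ := (b.beta * ρ - ρ ^ 2 - b.etil) / (b.beta - ρ)

/-- The residual-form Temple data are usable: Ritz data, admissible deflation, `0 ≤ Thi` (`= Ehi`), `beta ≤ 0`,
`Hhi - d ρhi² ≤ beta²`, `ρhi < beta`. [cite: ReedSimonIV1978, Thm. XIII.5] -/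
def templeOKR (b : KLBlock) (tab : List KLTrig) (χ : D4Irrep) : Bool :=
  b.ritzOK tab χ && b.deflOK tab χ && decide (0 ≤ b.Thi) && decide (b.beta ≤ 0) &&
    decide (b.Hhi - dmult χ * b.rhohi ^ 2 ≤ b.beta ^ 2) && decide (b.rhohi < b.beta)

/-- A certified lower bound for the channel bottom is available (residual form): Temple data on a trial block, far-channel
data on a block without trial. [folklore] -/
def lowerOKR (b : KLBlock) (tab : List KLTrig) (χ : D4Irrep) : Bool :=
  (b.useTrial && b.templeOKR tab χ) || (!b.useTrial && b.farOK tab χ)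

/-- The certified lower bound, residual form: `min (templeR ρlo) (templeR ρhi)` on a trial block, `-s` on a far block.
[folklore] -/
def lowerR (b : KLBlock) (tab : List KLTrig) (χ : D4Irrep) : ℚ :=
  if b.useTrial && b.templeOKR tab χ then min (b.templeR b.rholo) (b.templeR b.rhohi) else -b.s

/-- Kato's squared distance bound of the normalised trial to the bottom eigenspace, residual form: `ẽ/(β - ρhi)²`.
[folklore] -/
def katoR (b : KLBlock) : ℚ := b.etil / (b.beta - b.rhohi) ^ 2

end KLBlock

namespace KLBox

/-- The box is well formed and every channel has a certified lower bound (residual form); `B1g` and `E` have Ritz data on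
trial blocks without the bare-`U` term. [folklore] -/
def basicOKR (bx : KLBox) (tab : List KLTrig) : Bool :=
  decide (-4 < bx.mulo) && decide (bx.mulo ≤ bx.muhi) && decide (bx.muhi < 0) &&
    bx.bB1g.ritzOK tab .B1g && bx.bE.ritzOK tab .E && !bx.bB1g.withU && !bx.bE.withU &&
    bx.bA1g.lowerOKR tab .A1g && bx.bA2g.lowerOKR tab .A2g && bx.bB1g.lowerOKR tab .B1g &&
    bx.bB2g.lowerOKR tab .B2g && bx.bE.lowerOKR tab .E

/-- Two-channel isolation and negativity on the box (clauses N3, N4), residual form. [folklore] -/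
def isolationOKR (bx : KLBox) (tab : List KLTrig) (γ : ℚ) : Bool :=
  decide (bx.bB1g.upper < 0) && decide (bx.bE.upper < 0) &&
    decide (min bx.bB1g.upper bx.bE.upper + γ ≤ bx.bA1g.lowerR tab .A1g) &&
    decide (min bx.bB1g.upper bx.bE.upper + γ ≤ bx.bA2g.lowerR tab .A2g) &&
    decide (min bx.bB1g.upper bx.bE.upper + γ ≤ bx.bB2g.lowerR tab .B2g)

/-- `B1g` leads every other channel by `γ` (clause N1), residual form. [folklore] -/
def b1gLeadsOKR (bx : KLBox) (tab : List KLTrig) (γ : ℚ) : Bool :=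
  decide (bx.bB1g.upper + γ ≤ bx.bA1g.lowerR tab .A1g) && decide (bx.bB1g.upper + γ ≤ bx.bA2g.lowerR tab .A2g) &&
    decide (bx.bB1g.upper + γ ≤ bx.bB2g.lowerR tab .B2g) && decide (bx.bB1g.upper + γ ≤ bx.bE.lowerR tab .E)

/-- `E` leads every other channel by `γ` (clause N2), residual form. [folklore] -/
def eLeadsOKR (bx : KLBox) (tab : List KLTrig) (γ : ℚ) : Bool :=
  decide (bx.bE.upper + γ ≤ bx.bA1g.lowerR tab .A1g) && decide (bx.bE.upper + γ ≤ bx.bA2g.lowerR tab .A2g) &&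
    decide (bx.bE.upper + γ ≤ bx.bB2g.lowerR tab .B2g) && decide (bx.bE.upper + γ ≤ bx.bB1g.lowerR tab .B1g)

/-- Node covering on the box (clause N5) with the constant `cov`, residual form: Temple data on the `B1g` and `E` trial
blocks, simplicity of the `B1g` bottom (`Hhi < 2ρhi²`) and exact doublet for `E` (`Hhi < 3ρhi²`), the square-root witnesses
`r1 ≥ √(R2·katoR)`, `r2 ≤ √(p/Nhi)`, and `cov · L² ≤ (r2 - r1)²` with `r1 < r2` for both channels. [folklore] -/
def nodeOKR (bx : KLBox) (tab : List KLTrig) (cov : ℚ) : Bool :=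
  bx.bB1g.useTrial && bx.bE.useTrial && bx.bB1g.templeOKR tab .B1g && bx.bE.templeOKR tab .E &&
    decide (bx.bB1g.Hhi < 2 * bx.bB1g.rhohi ^ 2) && decide (bx.bE.Hhi < 3 * bx.bE.rhohi ^ 2) &&
    decide (0 ≤ bx.R2) && decide (0 < bx.pB) && decide (0 < bx.pE) &&
    decide (0 ≤ bx.bB1g.katoR) && decide (0 ≤ bx.bE.katoR) &&
    decide (0 ≤ bx.r1B) && decide (bx.R2 * bx.bB1g.katoR ≤ bx.r1B ^ 2) &&
    decide (0 ≤ bx.r2B) && decide (bx.r2B ^ 2 * bx.bB1g.Nhi ≤ bx.pB) && decide (bx.r1B < bx.r2B) &&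
    decide (0 ≤ bx.r1E) && decide (bx.R2 * bx.bE.katoR ≤ bx.r1E ^ 2) &&
    decide (0 ≤ bx.r2E) && decide (bx.r2E ^ 2 * bx.bE.Nhi ≤ bx.pE) && decide (bx.r1E < bx.r2E) &&
    decide (cov * (bx.bB1g.lowerR tab .B1g) ^ 2 ≤ (bx.r2B - bx.r1B) ^ 2) &&
    decide (cov * (bx.bE.lowerR tab .E) ^ 2 ≤ (bx.r2E - bx.r1E) ^ 2)

end KLBox

namespace KLCert

/-- **The named numerical hypothesis, residual form (enclosures E0, E1, E2, E3R, E4, E5, E6).** The fillings at the two window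
ends, and on every box, uniformly in `μ`, the residual-form block enclosures of the five channels and the node-covering
enclosures. [folklore] -/
def EnclosuresR (c : KLCert) : Prop :=
  KohnLuttinger.filling (squareDispersion 1 0) (c.mua : ℝ) ≤ 7 / 10 ∧
    (13 / 25 : ℝ) ≤ KohnLuttinger.filling (squareDispersion 1 0) (c.mub : ℝ) ∧
    ∀ bx ∈ c.boxes, ∀ μ ∈ Set.Icc (bx.mulo : ℝ) (bx.muhi : ℝ),
      (∀ χ : D4Irrep, (bx.blk χ).EnclosureR c.trials μ χ) ∧ bx.NodeEnclosure c.trials μ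

/-- **The checker, residual form.** Window ends in `(-4, 0)` with `mub < mua`, `gamma > 0`, `cov > 0`; boxes non-empty, well
formed, contiguous and covering `[mub, mua]`; on every box isolation/negativity (N3, N4) and node covering (N5); `B1g` leads on
some box containing `mua` (N1) and `E` leads on some box containing `mub` (N2). [folklore] -/
def checkR (c : KLCert) : Bool :=
  decide (-4 < c.mub) && decide (c.mub < c.mua) && decide (c.mua < 0) && decide (0 < c.gamma) &&
    decide (0 < c.cov) &&
    (match c.boxes.head?, c.boxes.getLast? with
      | some b₀, some b₁ => decide (b₀.mulo ≤ c.mub) && decide (c.mua ≤ b₁.muhi)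
      | _, _ => false) &&
    chainOK c.boxes &&
    (c.boxes.all fun bx => bx.basicOKR c.trials && bx.isolationOKR c.trials c.gamma && bx.nodeOKR c.trials c.cov) &&
    (c.boxes.any fun bx =>
      decide (bx.mulo ≤ c.mua) && decide (c.mua ≤ bx.muhi) && bx.b1gLeadsOKR c.trials c.gamma) &&
    (c.boxes.any fun bx =>
      decide (bx.mulo ≤ c.mub) && decide (c.mub ≤ bx.muhi) && bx.eLeadsOKR c.trials c.gamma)

end KLCert

/-- The residual-form Temple function is `ρ - ẽ/(β - ρ)` away from the pole (so it is concave in `ρ` below `β`).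
[folklore] -/
theorem klR_templeR_eq : ∀ (b : KLBlock) (ρ : ℚ), b.beta - ρ ≠ 0 → b.templeR ρ = ρ - b.etil / (b.beta - ρ) := by
  intro b ρ h
  unfold KLBlock.templeR
  field_simp

end Summit.HubbardSuperconductivity.HubbardSuperconductivity.Theorems.CwKLChiralWindow

end
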